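import Summits.AtomisticToContinuum.FouriersLaw.Theorems.BondHeatUncertaintyBoundedResponseTotalBondComparisonA

/-!
# NODE 105 «TotalBondComparison» — part B of 3 (sequel of `…TotalBondComparisonA`): §3 along the constructed flow — block telescoping and the total-heat identity

Split for the 400-line cap by the landing lane (hand-2 g38) — 3-way cut at the lens's own markers (l.380 / l.544) approved by critic row 1446 (A); same namespace
`…Theorems.BoundedResponse.HeatSpreading`, opens and `variable {N : ℕ}` throughout; all FQNs unchanged; bodies verbatim.  0 sorry; standard axioms.
-/

noncomputable section

open MeasureTheory ProbabilityTheory Filter Topology Set Function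
open scoped NNReal ENNReal
open Literature.MathematicalPhysics.KineticTheory.HeatConduction
open Literature.MathematicalPhysics.KineticTheory OscillatorChain
open Literature.Probability.Process
open Summit.AtomisticToContinuum.FouriersLaw.Theorems.SubdiffusiveBondHeat


namespace Summit.AtomisticToContinuum.FouriersLaw.Theorems.BoundedResponse.HeatSpreading

open Summit.AtomisticToContinuum.FouriersLaw.Theorems.BoundedResponse.TransientContact
  (gibbsBondHeatVar gibbsBondCorr blockEnergyLeft blockEnergyLeftVar ExtensiveBlockEnergyVariance)
open Summit.AtomisticToContinuum.FouriersLaw.Theorems.BoundedResponse.ParityFloor (extensiveBlockEnergyVariance_holds)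
open Summit.AtomisticToContinuum.FouriersLaw.Theses.BondHeatUncertainty (BoundedResponse SubdiffusiveBondHeat)

variable {N : ℕ}

/-! ## §3 Along the constructed flow: block telescoping and the total-heat identity

For the constructed solution map `z_s = Φ_s(x, w) = solMap N T_L T_R s x w` (the flow driven by the bath noise
`chainNoise`, which vanishes at every interior site) the block bond heats telescope:
`∫₀ᵗ j_b(z) + ΔE_{≤b} = ∫₀ᵗ j_0(z) + ΔE_{≤0}` for every bond `b` (`b + 1 < N`), whence the TOTAL-HEAT IDENTITY
`∫₀ᵗ J(z) = (N−1)∫₀ᵗ j_b(z) + F_b(z_t) − F_b(x)` with the left-energy spread `F_b = ∑_{i+1<N} (E_{≤b} − E_{≤i})`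
(`j_{N−1} ≡ 0`). Deterministic, path by path, every `x` and every pair of raw paths `w`. -/

section Flow

variable {ω₂ lam β γ : ℝ}

/-- The bath noise does not touch the interior sites: `η_k ≡ 0` for `k ≠ 0, N−1`. [folklore] -/
theorem chainNoise_apply_eq_zero_of_interior (c_L c_R : ℝ) (w : WienerPair) (s : ℝ) {k : Fin N}
    (hk0 : k.val ≠ 0) (hkN : k.val ≠ N - 1) : chainNoise N c_L c_R w s k = 0 := by
  simp [chainNoise, hk0, hkN]

/-- **The LEFT-ENERGY SPREAD about the bond `b`**: `F_b = ∑_{i : i+1<N} (E_{≤b} − E_{≤i})`, the static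
observable through which the total heat `∫₀ᵗ J` differs from `(N−1)` copies of the bond heat `∫₀ᵗ j_b`
(`pinnedChain_totalHeat_eq`). [formal bookkeeping] -/
def leftSpread (P : OscillatorChain) (N b : ℕ) (y : PhaseSpace N) : ℝ :=
  ∑ i : Fin N, if i.val + 1 < N then blockEnergyLeft P N b y - blockEnergyLeft P N i.val y else 0

/-- `∑_{i : Fin N} [i + 1 < N] = N − 1` (`N ≥ 1`). [formal bookkeeping] -/
theorem sum_ite_succ_lt_eq (hN : 0 < N) : (∑ i : Fin N, if i.val + 1 < N then (1 : ℝ) else 0) = (N : ℝ) - 1 := by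
  obtain ⟨n, rfl⟩ : ∃ n, N = n + 1 := ⟨N - 1, by omega⟩
  rw [Fin.sum_univ_castSucc]
  have h1 : ∀ i : Fin n, (if (Fin.castSucc i).val + 1 < n + 1 then (1 : ℝ) else 0) = 1 := fun i => by
    rw [if_pos]
    rw [Fin.val_castSucc]
    have := i.isLt
    omega
  have h2 : (if (Fin.last n).val + 1 < n + 1 then (1 : ℝ) else 0) = 0 := by
    rw [if_neg]
    rw [Fin.val_last]
    omega
  simp only [h1, h2, Finset.sum_const, Finset.card_univ, Fintype.card_fin, nsmul_eq_mul, mul_one, add_zero]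
  push_cast
  ring

/-- Bookkeeping of the total-heat identity: `∑_i [c_i](B + (u − v) − (f_i − g_i)) =
(∑_i [c_i])·B + (∑_i [c_i](u − f_i) − ∑_i [c_i](v − g_i))`. [formal bookkeeping] -/
theorem sum_ite_bookkeeping {ι : Type*} (s : Finset ι) (c : ι → Prop) [DecidablePred c] (B u v : ℝ)
    (f g : ι → ℝ) :
    (∑ i ∈ s, if c i then B + (u - v) - (f i - g i) else 0) =
      (∑ i ∈ s, if c i then (1 : ℝ) else 0) * B +
        ((∑ i ∈ s, if c i then u - f i else 0) - ∑ i ∈ s, if c i then v - g i else 0) := by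
  rw [Finset.sum_mul, ← Finset.sum_sub_distrib, ← Finset.sum_add_distrib]
  refine Finset.sum_congr rfl fun i _ => ?_
  split_ifs <;> ring

variable (hω : 0 < ω₂) (hl : 0 ≤ lam) (hβ : 0 ≤ β) (hγ : 0 ≤ γ) (T_L T_R : ℝ)
include hω hl hβ hγ

/-- The interior site-energy balance ALONG THE CONSTRUCTED FLOW `z_s = solMap N T_L T_R s x w`:
`e_k(z_t) = e_k(x) + ∫₀ᵗ (j_{k−1}(z_s) − j_k(z_s)) ds` (the bath noise vanishes at the interior site `k`).
[folklore] -/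
theorem pinnedChain_splitSiteEnergy_interior_solMap_eq {km k kp : Fin N} (hkm : km.val + 1 = k.val)
    (hkp : kp.val = k.val + 1) (x : PhaseSpace N) (w : WienerPair) {t : ℝ} (ht : 0 ≤ t) :
    splitSiteEnergy (pinnedChain ω₂ lam β γ) N k ((pinnedChain ω₂ lam β γ).solMap N T_L T_R t x w) =
      splitSiteEnergy (pinnedChain ω₂ lam β γ) N k x +
        ∫ s in (0 : ℝ)..t, ((pinnedChain ω₂ lam β γ).bondCurrent N km ((pinnedChain ω₂ lam β γ).solMap N T_L T_R s x w) -
          (pinnedChain ω₂ lam β γ).bondCurrent N k ((pinnedChain ω₂ lam β γ).solMap N T_L T_R s x w)) :=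
  pinnedChain_splitSiteEnergy_interior_chainFlow_eq hω hl hβ hγ hkm hkp x (continuous_chainNoise _ _ w)
    (fun s => chainNoise_apply_eq_zero_of_interior _ _ w s (by omega) (by have := kp.isLt; omega)) ht

/-- The bond heats along the constructed flow are interval-integrable (continuity). [formal bookkeeping] -/
theorem pinnedChain_intervalIntegrable_bondCurrent_solMap (x : PhaseSpace N) (w : WienerPair) (i : Fin N)
    (a c : ℝ) :
    IntervalIntegrable (fun s => (pinnedChain ω₂ lam β γ).bondCurrent N i
      ((pinnedChain ω₂ lam β γ).solMap N T_L T_R s x w)) volume a c := by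
  have hzc : Continuous fun s => (pinnedChain ω₂ lam β γ).solMap N T_L T_R s x w :=
    pinnedChain_continuous_chainFlow hω hl hβ hγ N x (continuous_chainNoise _ _ w)
  exact ((pinnedChain_continuous_bondCurrent ω₂ lam β γ N i).comp hzc).intervalIntegrable _ _

/-- Block telescoping, `ℕ`-indexed form: `∫₀ᵗ j_b(z) + ΔE_{≤b} = ∫₀ᵗ j_0(z) + ΔE_{≤0}` for every `b` with
`b + 1 < N` (induction on `b` through `E_{≤b+1} − E_{≤b} = e_{b+1}` and the interior balance at `b + 1`).
[folklore] -/
theorem pinnedChain_bondHeat_add_blockEnergyLeft_eq_aux (x : PhaseSpace N) (w : WienerPair) {t : ℝ}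
    (ht : 0 ≤ t) :
    ∀ (b : ℕ) (hb : b + 1 < N),
      (∫ s in (0 : ℝ)..t, (pinnedChain ω₂ lam β γ).bondCurrent N ⟨b, by omega⟩
          ((pinnedChain ω₂ lam β γ).solMap N T_L T_R s x w)) +
          (blockEnergyLeft (pinnedChain ω₂ lam β γ) N b ((pinnedChain ω₂ lam β γ).solMap N T_L T_R t x w) -
            blockEnergyLeft (pinnedChain ω₂ lam β γ) N b x) =
        (∫ s in (0 : ℝ)..t, (pinnedChain ω₂ lam β γ).bondCurrent N ⟨0, by omega⟩
          ((pinnedChain ω₂ lam β γ).solMap N T_L T_R s x w)) +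
          (blockEnergyLeft (pinnedChain ω₂ lam β γ) N 0 ((pinnedChain ω₂ lam β γ).solMap N T_L T_R t x w) -
            blockEnergyLeft (pinnedChain ω₂ lam β γ) N 0 x) := by
  intro b
  induction b with
  | zero => intro hb; rfl
  | succ b ih =>
    intro hb
    have hb1 : b + 1 < N := by omega
    have ih' := ih hb1
    have hE : ∀ y, blockEnergyLeft (pinnedChain ω₂ lam β γ) N (b + 1) y =
        blockEnergyLeft (pinnedChain ω₂ lam β γ) N b y + splitSiteEnergy (pinnedChain ω₂ lam β γ) N ⟨b + 1, hb1⟩ y :=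
      fun y => by
        have := blockEnergyLeft_succ_sub (pinnedChain ω₂ lam β γ) hb1 y
        linarith
    have hsite := pinnedChain_splitSiteEnergy_interior_solMap_eq hω hl hβ hγ T_L T_R (km := ⟨b, by omega⟩)
      (k := ⟨b + 1, hb1⟩) (kp := ⟨b + 1 + 1, hb⟩) rfl rfl x w ht
    rw [intervalIntegral.integral_sub
      (pinnedChain_intervalIntegrable_bondCurrent_solMap hω hl hβ hγ T_L T_R x w _ 0 t)
      (pinnedChain_intervalIntegrable_bondCurrent_solMap hω hl hβ hγ T_L T_R x w _ 0 t)] at hsite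
    rw [hE, hE, ← ih']
    linarith

/-- **Block telescoping**: along the constructed flow, `∫₀ᵗ j_i(z) + (E_{≤i}(z_t) − E_{≤i}(x))` is the SAME for
every bond `i` (`i + 1 < N`) — here against a bond given by its natural-number label `b`. [folklore] -/
theorem pinnedChain_bondHeat_add_blockEnergyLeft_eq (x : PhaseSpace N) (w : WienerPair) {t : ℝ} (ht : 0 ≤ t)
    {i : Fin N} (hi : i.val + 1 < N) {b : ℕ} (hb : b + 1 < N) :
    (∫ s in (0 : ℝ)..t, (pinnedChain ω₂ lam β γ).bondCurrent N i
        ((pinnedChain ω₂ lam β γ).solMap N T_L T_R s x w)) +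
        (blockEnergyLeft (pinnedChain ω₂ lam β γ) N i.val ((pinnedChain ω₂ lam β γ).solMap N T_L T_R t x w) -
          blockEnergyLeft (pinnedChain ω₂ lam β γ) N i.val x) =
      (∫ s in (0 : ℝ)..t, (pinnedChain ω₂ lam β γ).bondCurrent N ⟨b, by omega⟩
        ((pinnedChain ω₂ lam β γ).solMap N T_L T_R s x w)) +
        (blockEnergyLeft (pinnedChain ω₂ lam β γ) N b ((pinnedChain ω₂ lam β γ).solMap N T_L T_R t x w) -
          blockEnergyLeft (pinnedChain ω₂ lam β γ) N b x) := by
  have h1 := pinnedChain_bondHeat_add_blockEnergyLeft_eq_aux hω hl hβ hγ T_L T_R x w ht i.val hi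
  have h2 := pinnedChain_bondHeat_add_blockEnergyLeft_eq_aux hω hl hβ hγ T_L T_R x w ht b hb
  simp only [Fin.eta] at h1
  rw [h1, h2]

/-- **The total-heat identity** along the constructed flow (every `x`, every `w`, `t ≥ 0`, every bond `b` with
`b + 1 < N`): `∫₀ᵗ J(z_s) ds = (N − 1)·∫₀ᵗ j_b(z_s) ds + F_b(z_t) − F_b(x)`, `J = ∑_i j_i`,
`F_b = leftSpread` — block telescoping summed over the `N − 1` bonds, `j_{N−1} ≡ 0`. [folklore] -/
theorem pinnedChain_totalHeat_eq (x : PhaseSpace N) (w : WienerPair) {t : ℝ} (ht : 0 ≤ t) {b : ℕ} (hb : b + 1 < N) :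
    (∫ s in (0 : ℝ)..t, ∑ i : Fin N, (pinnedChain ω₂ lam β γ).bondCurrent N i
        ((pinnedChain ω₂ lam β γ).solMap N T_L T_R s x w)) =
      ((N : ℝ) - 1) * (∫ s in (0 : ℝ)..t, (pinnedChain ω₂ lam β γ).bondCurrent N ⟨b, by omega⟩
          ((pinnedChain ω₂ lam β γ).solMap N T_L T_R s x w)) +
        (leftSpread (pinnedChain ω₂ lam β γ) N b ((pinnedChain ω₂ lam β γ).solMap N T_L T_R t x w) -
          leftSpread (pinnedChain ω₂ lam β γ) N b x) := by
  have hN : 0 < N := by omega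
  rw [intervalIntegral.integral_finsetSum fun i _ =>
    pinnedChain_intervalIntegrable_bondCurrent_solMap hω hl hβ hγ T_L T_R x w i 0 t]
  have hterm : ∀ i : Fin N,
      (∫ s in (0 : ℝ)..t, (pinnedChain ω₂ lam β γ).bondCurrent N i ((pinnedChain ω₂ lam β γ).solMap N T_L T_R s x w)) =
        if i.val + 1 < N then
          (∫ s in (0 : ℝ)..t, (pinnedChain ω₂ lam β γ).bondCurrent N ⟨b, by omega⟩
              ((pinnedChain ω₂ lam β γ).solMap N T_L T_R s x w)) +
            (blockEnergyLeft (pinnedChain ω₂ lam β γ) N b ((pinnedChain ω₂ lam β γ).solMap N T_L T_R t x w) -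
              blockEnergyLeft (pinnedChain ω₂ lam β γ) N b x) -
            (blockEnergyLeft (pinnedChain ω₂ lam β γ) N i.val ((pinnedChain ω₂ lam β γ).solMap N T_L T_R t x w) -
              blockEnergyLeft (pinnedChain ω₂ lam β γ) N i.val x)
        else 0 := by
    intro i
    by_cases hi : i.val + 1 < N
    · rw [if_pos hi, ← pinnedChain_bondHeat_add_blockEnergyLeft_eq hω hl hβ hγ T_L T_R x w ht hi hb]
      ring
    · rw [if_neg hi]
      have hi' : i.val + 1 = N := by have := i.isLt; omega
      simp [(pinnedChain ω₂ lam β γ).bondCurrent_eq_zero_of_last N i hi']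
  rw [Finset.sum_congr rfl fun i _ => hterm i, sum_ite_bookkeeping, sum_ite_succ_lt_eq hN]
  rfl

end Flow

end Summit.AtomisticToContinuum.FouriersLaw.Theorems.BoundedResponse.HeatSpreading

end
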